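import Summits.AtomisticToContinuum.FouriersLaw.Theorems.LatticeLandauDampingAbelThermodynamicLimitOfSignLaws
import Summits.AtomisticToContinuum.FouriersLaw.Theses.StaticAbelianSqueeze

/-!
# Crux `AbelThermodynamicLimit` from the EXISTING item (R) `StaticAbelianSqueeze.UniformAbelianRegularity` (lead c2, cycle 3)

Support file for the crux `stmt-AtomisticToContinuum-14013` (`LatticeLandauDamping.AbelThermodynamicLimit`; `Iff.rfl`-twin
`stmt-12596`). With the fixed-frequency matching S3 of line SketchIdeator2 a THEOREM (`fixedFrequencyMatching_of_registeredLeaves`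
over the landed leaves (C′) p115961 and (B′) p126508) and the open-chain Kubo–Abel identity (K) landed (`kuboAbelIdentity_holds`),
the `ν ↓ 0 ↔ N → ∞` exchange is ALL that separates a shift-invariant Abelian Green–Kubo witness from `D_N → κ`; in its weakest,
rate-free form that exchange is verbatim the open crux (R) = `UniformAbelianRegularity` of route `StaticAbelianSqueeze`
(item `stmt-AtomisticToContinuum-13416`): `∀ ε > 0 ∃ ν₀ ∀ ν ∈ (0, ν₀)`, eventually in `N`, `|∫₀^∞ (1 − e^{-νt}) c_N| ≤ εN`.

* `tendsto_of_regularity_matching_abel` — the abstract real analysis: `(N−1)T²D_N = F_N(ν) + I_N(ν)` (K + linearity),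
  `|I_N(ν)| ≤ εN` eventually for small `ν` ((R)), `F_N(ν)/N → Â(ν)` (S3), `Â(ν) → T²κ` (witness) ⟹ `D_N → κ`.
* `stub_repairedCruxOfUniformAbelianRegularity` (registered on stmt-14013) — (R) ALONE proves the planner-REPAIRED crux
  (shift-invariant witness clause in the hypothesis; conclusion verbatim): regularise the witness (seam lemmas + same-`κ` restriction
  `exists_regularDynamics_sameKappa`), apply S3, (K) and the lemma above; the OUTPUT witness is the given one.
* `abelThermodynamicLimit_of_uniformAbelianRegularity` — (R) and the seam SI (`stub_witnessShiftInvariant`, the planner repair) prove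
  the crux BY NAME.
* `regularityEstimate_of_tendsto` — conversely, at a parameter point and temperature carrying a shift-invariant witness, `D_N → κ` for
  ONE response sequence gives the (R)-estimate there: so, given Abelian witnesses, the repaired crux and (R) are EQUIVALENT, and the
  line's sign laws QS ∧ QSR (which give the repaired crux, `abelThermodynamicLimitRepaired_of_signLaws`) are a STRENGTHENING of (R).

Consequence for the crux chain: every line of both twin cruxes closes on (R) = stmt-13416 (+ the seam repair). Nothing here closes
the item.
-/

noncomputable section

namespace Summit.AtomisticToContinuum.FouriersLaw.Theorems.AbelThermodynamicLimit.SeriesLawAtEveryLaplaceFrequency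

open MeasureTheory Filter Set Topology
open Literature.MathematicalPhysics.KineticTheory.HeatConduction

/-! ## Abstract real analysis -/

/-- **The exchange lemma, abstract form.** Sequences `G N ν` (= `F_N(ν)`), `I N ν` (= `∫₀^∞(1−e^{-νt})c_N`), `G0 N`
(= `∫₀^∞ c_N`), a function `g` (= `Â`) and numbers `Tsq > 0`, `κ`: if `G0 N = G N ν + I N ν` (`ν > 0`),
`(N−1)·Tsq·Dn N = G0 N`, the (R)-estimate `∀ ε>0 ∃ ν₀>0 ∀ ν∈(0,ν₀) ∃ N₀ ∀ N≥N₀, |I N ν| ≤ εN`, the matching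
`G N ν / N → g ν` (`ν > 0`) and the Abel limit `g → Tsq·κ` at `0⁺` hold, then `Dn → κ`. [folklore] -/
theorem tendsto_of_regularity_matching_abel (G I : ℕ → ℝ → ℝ) (G0 : ℕ → ℝ) (g : ℝ → ℝ) (Dn : ℕ → ℝ)
    (Tsq κ : ℝ) (hT : 0 < Tsq)
    (hsplit : ∀ ν : ℝ, 0 < ν → ∀ N : ℕ, G0 N = G N ν + I N ν)
    (hK : ∀ N : ℕ, ((N : ℝ) - 1) * Tsq * Dn N = G0 N)
    (hR : ∀ ε : ℝ, 0 < ε → ∃ ν₀ : ℝ, 0 < ν₀ ∧ ∀ ν : ℝ, 0 < ν → ν < ν₀ → ∃ N₀ : ℕ, ∀ N : ℕ, N₀ ≤ N → |I N ν| ≤ ε * N)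
    (hM : ∀ ν : ℝ, 0 < ν → Tendsto (fun N : ℕ => G N ν / N) atTop (𝓝 (g ν)))
    (hA : Tendsto g (𝓝[>] 0) (𝓝 (Tsq * κ))) :
    Tendsto Dn atTop (𝓝 κ) := by
  -- step 1: `G0 N / N → Tsq κ`
  have hu : Tendsto (fun N : ℕ => G0 N / N) atTop (𝓝 (Tsq * κ)) := by
    rw [Metric.tendsto_atTop]
    intro ε hε
    have hε3 : 0 < ε / 3 := by positivity
    obtain ⟨δ, hδ, hAδ⟩ := Metric.tendsto_nhdsWithin_nhds.1 hA (ε / 3) hε3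
    obtain ⟨ν₀, hν₀, hRν⟩ := hR (ε / 3) hε3
    set ν : ℝ := min ν₀ δ / 2 with hνdef
    have hν : 0 < ν := by positivity
    have hν1 : ν < ν₀ := by
      have : min ν₀ δ ≤ ν₀ := min_le_left _ _
      rw [hνdef]; linarith
    have hν2 : ν < δ := by
      have : min ν₀ δ ≤ δ := min_le_right _ _
      rw [hνdef]; linarith
    have hg : dist (g ν) (Tsq * κ) < ε / 3 := hAδ (by exact hν) (by rwa [Real.dist_eq, sub_zero, abs_of_pos hν])
    obtain ⟨N₂, hN₂⟩ := hRν ν hν hν1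
    obtain ⟨N₁, hN₁⟩ := (Metric.tendsto_atTop.1 (hM ν hν)) (ε / 3) hε3
    refine ⟨max (max N₁ N₂) 1, fun N hN => ?_⟩
    have hN1 : N₁ ≤ N := le_trans (le_trans (le_max_left _ _) (le_max_left _ _)) hN
    have hN2 : N₂ ≤ N := le_trans (le_trans (le_max_right _ _) (le_max_left _ _)) hN
    have hNpos : (0 : ℝ) < N := by exact_mod_cast (le_trans (le_max_right _ _) hN)
    have h1 : dist (G N ν / N) (g ν) < ε / 3 := hN₁ N hN1
    have h2 : |I N ν| ≤ ε / 3 * N := hN₂ N hN2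
    have h2' : |I N ν / N| ≤ ε / 3 := by
      rw [abs_div, abs_of_pos hNpos, div_le_iff₀ hNpos]
      exact h2
    rw [Real.dist_eq] at h1 hg ⊢
    have e : G0 N / N - Tsq * κ = (G N ν / N - g ν) + I N ν / N + (g ν - Tsq * κ) := by
      rw [hsplit ν hν N]; ring
    rw [e]
    calc |G N ν / ↑N - g ν + I N ν / ↑N + (g ν - Tsq * κ)|
        ≤ |G N ν / ↑N - g ν + I N ν / ↑N| + |g ν - Tsq * κ| := abs_add_le _ _
      _ ≤ |G N ν / ↑N - g ν| + |I N ν / ↑N| + |g ν - Tsq * κ| := by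
          linarith [abs_add_le (G N ν / ↑N - g ν) (I N ν / ↑N)]
      _ < ε / 3 + ε / 3 + ε / 3 := by linarith
      _ = ε := by ring
  -- step 2: `Dn N = (G0 N / N) · (N / ((N−1) Tsq))` for `N ≥ 2`, and the second factor tends to `1/Tsq`
  have hfac : Tendsto (fun N : ℕ => (N : ℝ) / (((N : ℝ) - 1) * Tsq)) atTop (𝓝 (1 / Tsq)) := by
    have h1 : Tendsto (fun N : ℕ => (1 : ℝ) - 1 / (N : ℝ)) atTop (𝓝 (1 - 0)) :=
      tendsto_const_nhds.sub tendsto_one_div_atTop_nhds_zero_nat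
    rw [sub_zero] at h1
    have h2 : Tendsto (fun N : ℕ => ((1 : ℝ) - 1 / (N : ℝ))⁻¹ * (1 / Tsq)) atTop (𝓝 (1⁻¹ * (1 / Tsq))) :=
      (h1.inv₀ one_ne_zero).mul tendsto_const_nhds
    rw [inv_one, one_mul] at h2
    refine h2.congr' ?_
    filter_upwards [eventually_ge_atTop 2] with N hN
    have hN2 : (2 : ℝ) ≤ N := by exact_mod_cast hN
    have hN0 : (N : ℝ) ≠ 0 := by positivity
    have hN1 : (N : ℝ) - 1 ≠ 0 := by
      have : (0:ℝ) < (N:ℝ) - 1 := by linarith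
      exact this.ne'
    field_simp
  have hprod := hu.mul hfac
  rw [show Tsq * κ * (1 / Tsq) = κ by field_simp] at hprod
  refine hprod.congr' ?_
  filter_upwards [eventually_ge_atTop 2] with N hN
  have hN2 : (2 : ℝ) ≤ N := by exact_mod_cast hN
  have hN0 : (N : ℝ) ≠ 0 := by positivity
  have hN1 : (N : ℝ) - 1 ≠ 0 := by
    have : (0:ℝ) < (N:ℝ) - 1 := by linarith
    exact this.ne'
  rw [← hK N]
  field_simp

/-- **The converse estimate, abstract form.** With the same bookkeeping, if `Dn → κ` then the (R)-estimate holds: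
`∀ ε>0 ∃ ν₀>0 ∀ ν∈(0,ν₀) ∃ N₀ ∀ N≥N₀, |I N ν| ≤ εN`. [folklore] -/
theorem regularity_of_tendsto_matching_abel (G I : ℕ → ℝ → ℝ) (G0 : ℕ → ℝ) (g : ℝ → ℝ) (Dn : ℕ → ℝ)
    (Tsq κ : ℝ) (hT : 0 < Tsq)
    (hsplit : ∀ ν : ℝ, 0 < ν → ∀ N : ℕ, G0 N = G N ν + I N ν)
    (hK : ∀ N : ℕ, ((N : ℝ) - 1) * Tsq * Dn N = G0 N)
    (hM : ∀ ν : ℝ, 0 < ν → Tendsto (fun N : ℕ => G N ν / N) atTop (𝓝 (g ν)))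
    (hA : Tendsto g (𝓝[>] 0) (𝓝 (Tsq * κ))) (hD : Tendsto Dn atTop (𝓝 κ)) :
    ∀ ε : ℝ, 0 < ε → ∃ ν₀ : ℝ, 0 < ν₀ ∧ ∀ ν : ℝ, 0 < ν → ν < ν₀ → ∃ N₀ : ℕ, ∀ N : ℕ, N₀ ≤ N → |I N ν| ≤ ε * N := by
  intro ε hε
  have hε3 : 0 < ε / 3 := by positivity
  -- `G0 N / N = Tsq · Dn N · (N−1)/N → Tsq κ`
  have hu : Tendsto (fun N : ℕ => G0 N / N) atTop (𝓝 (Tsq * κ)) := by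
    have h1 : Tendsto (fun N : ℕ => (1 : ℝ) - 1 / (N : ℝ)) atTop (𝓝 (1 - 0)) :=
      tendsto_const_nhds.sub tendsto_one_div_atTop_nhds_zero_nat
    rw [sub_zero] at h1
    have h2 := (h1.mul (hD.const_mul Tsq))
    rw [one_mul] at h2
    refine h2.congr' ?_
    filter_upwards [eventually_ge_atTop 1] with N hN
    have hN0 : (N : ℝ) ≠ 0 := by
      have : (1:ℝ) ≤ N := by exact_mod_cast hN
      positivity
    rw [← hK N]
    field_simp
  obtain ⟨δ, hδ, hAδ⟩ := Metric.tendsto_nhdsWithin_nhds.1 hA (ε / 3) hε3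
  refine ⟨δ, hδ, fun ν hν hνδ => ?_⟩
  have hg : dist (g ν) (Tsq * κ) < ε / 3 := hAδ (by exact hν) (by rwa [Real.dist_eq, sub_zero, abs_of_pos hν])
  obtain ⟨N₁, hN₁⟩ := (Metric.tendsto_atTop.1 (hM ν hν)) (ε / 3) hε3
  obtain ⟨N₂, hN₂⟩ := (Metric.tendsto_atTop.1 hu) (ε / 3) hε3
  refine ⟨max (max N₁ N₂) 1, fun N hN => ?_⟩
  have hN1 : N₁ ≤ N := le_trans (le_trans (le_max_left _ _) (le_max_left _ _)) hN
  have hN2 : N₂ ≤ N := le_trans (le_trans (le_max_right _ _) (le_max_left _ _)) hN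
  have hNpos : (0 : ℝ) < N := by exact_mod_cast (le_trans (le_max_right _ _) hN)
  have h1 := hN₁ N hN1
  have h2 := hN₂ N hN2
  rw [Real.dist_eq] at h1 h2 hg
  have e : I N ν = N * ((G0 N / N - Tsq * κ) - (G N ν / N - g ν) - (g ν - Tsq * κ)) := by
    rw [hsplit ν hν N]; field_simp; ring
  rw [e, abs_mul, abs_of_pos hNpos, mul_comm]
  refine mul_le_mul_of_nonneg_right ?_ hNpos.le
  calc |G0 N / ↑N - Tsq * κ - (G N ν / ↑N - g ν) - (g ν - Tsq * κ)|
      ≤ |G0 N / ↑N - Tsq * κ - (G N ν / ↑N - g ν)| + |g ν - Tsq * κ| := abs_sub _ _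
    _ ≤ |G0 N / ↑N - Tsq * κ| + |G N ν / ↑N - g ν| + |g ν - Tsq * κ| := by
        linarith [abs_sub (G0 N / ↑N - Tsq * κ) (G N ν / ↑N - g ν)]
    _ ≤ ε := by linarith

/-- **The Abelian split of `∫₀^∞ c` at frequency `ν > 0`** (linearity of the Bochner integral; `c ∈ L¹(0,∞)`):
`∫ c = ∫ e^{-νt} c + ∫ (1 − e^{-νt}) c` (as in `StaticAbelianSqueeze.closes`). [folklore] -/
theorem integral_abelSplit (c : ℝ → ℝ) (ν : ℝ) (hν : 0 < ν) (hc : IntegrableOn c (Ioi 0)) :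
    ∫ t in Ioi (0:ℝ), c t = (∫ t in Ioi (0:ℝ), Real.exp (-(ν * t)) * c t) +
      ∫ t in Ioi (0:ℝ), (1 - Real.exp (-(ν * t))) * c t := by
  have hcont : Continuous fun t : ℝ => Real.exp (-(ν * t)) := by fun_prop
  have hcont' : Continuous fun t : ℝ => 1 - Real.exp (-(ν * t)) := by fun_prop
  have hle : ∀ t : ℝ, t ∈ Ioi (0:ℝ) → Real.exp (-(ν * t)) ≤ 1 := fun t ht =>
    Real.exp_le_one_iff.2 (by have : 0 ≤ ν * t := mul_nonneg hν.le (le_of_lt ht); linarith)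
  have h1 : IntegrableOn (fun t => Real.exp (-(ν * t)) * c t) (Ioi 0) := by
    refine Integrable.mono hc (hcont.aestronglyMeasurable.mul hc.aestronglyMeasurable) ?_
    refine (ae_restrict_iff' measurableSet_Ioi).2 (Eventually.of_forall fun t ht => ?_)
    rw [norm_mul, Real.norm_eq_abs, abs_of_pos (Real.exp_pos _)]
    exact mul_le_of_le_one_left (norm_nonneg _) (hle t ht)
  have h2 : IntegrableOn (fun t => (1 - Real.exp (-(ν * t))) * c t) (Ioi 0) := by
    refine Integrable.mono hc (hcont'.aestronglyMeasurable.mul hc.aestronglyMeasurable) ?_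
    refine (ae_restrict_iff' measurableSet_Ioi).2 (Eventually.of_forall fun t ht => ?_)
    have h0 : 0 ≤ 1 - Real.exp (-(ν * t)) := by linarith [hle t ht]
    have h1' : 1 - Real.exp (-(ν * t)) ≤ 1 := by linarith [Real.exp_pos (-(ν * t))]
    rw [norm_mul, Real.norm_eq_abs, abs_of_nonneg h0]
    exact mul_le_of_le_one_left (norm_nonneg _) h1'
  calc ∫ t in Ioi (0:ℝ), c t
      = ∫ t in Ioi (0:ℝ), (Real.exp (-(ν * t)) * c t + (1 - Real.exp (-(ν * t))) * c t) := by
        congr 1; funext t; ring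
    _ = (∫ t in Ioi (0:ℝ), Real.exp (-(ν * t)) * c t) +
          ∫ t in Ioi (0:ℝ), (1 - Real.exp (-(ν * t))) * c t := integral_add h1 h2

/-! ## The chain: (R) ⇒ the repaired crux; (R) ∧ SI ⇒ the crux; and the converse estimate -/

/-- **Registered stub `stub_repairedCruxOfUniformAbelianRegularity`: (R) = `StaticAbelianSqueeze.UniformAbelianRegularity`
(item stmt-AtomisticToContinuum-13416) ALONE proves the planner-REPAIRED crux** (witness clause of the hypothesis with
`IsShiftInvariant μT`; conclusion verbatim the crux's). Proof: output the given witness; for a response sequence `Dn`: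
shift-invariant ⇒ tight ⇒ regular state, same-`κ` restriction of the dynamics to `bmGood` orbits, landed S3
(`fixedFrequencyMatching_of_registeredLeaves`) for `F_N(ν)/N → Â(ν)`, landed (K) for `c_N ∈ L¹`, `(N−1)T²Dn N = ∫ c_N`,
`integral_abelSplit`, and `tendsto_of_regularity_matching_abel`. [folklore] -/
theorem stub_repairedCruxOfUniformAbelianRegularity :
    Summit.AtomisticToContinuum.FouriersLaw.Theses.StaticAbelianSqueeze.UniformAbelianRegularity →
    ∀ ω₂ lam β γ : ℝ, 0 < ω₂ → 0 < lam → 0 < β → 0 < γ →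
    (∀ (N : ℕ) (T_L T_R : ℝ), 0 < T_L → 0 < T_R → ∀ μ ν : MeasureTheory.Measure (Literature.MathematicalPhysics.KineticTheory.HeatConduction.PhaseSpace N),
    (Literature.MathematicalPhysics.KineticTheory.HeatConduction.pinnedChain ω₂ lam β γ).IsSteadyState N T_L T_R μ → (Literature.MathematicalPhysics.KineticTheory.HeatConduction.pinnedChain ω₂ lam β γ).IsSteadyState N T_L T_R ν → μ = ν) →
    ∀ T : ℝ, 0 < T →
    (∃ (μT : MeasureTheory.Measure Literature.MathematicalPhysics.KineticTheory.HeatConduction.ChainConfig) (D : Literature.MathematicalPhysics.KineticTheory.HeatConduction.InfiniteChainDynamics (Literature.MathematicalPhysics.KineticTheory.HeatConduction.pinnedChain ω₂ lam β γ)) (κ : ℝ),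
    (Literature.MathematicalPhysics.KineticTheory.HeatConduction.pinnedChain ω₂ lam β γ).IsChainGibbsMeasure T μT ∧ Literature.MathematicalPhysics.KineticTheory.HeatConduction.IsShiftInvariant μT ∧ D.PreservesMeasure μT ∧
    (∀ t : ℝ, D.HasAbsConvergentCorrelation μT t) ∧ 0 < κ ∧
    Filter.Tendsto (fun ν : ℝ => (T ^ 2)⁻¹ * MeasureTheory.integral (MeasureTheory.volume.restrict (Set.Ioi (0:ℝ)))
    (fun t : ℝ => Real.exp (-(ν * t)) * (D.currentCorrelation μT) t)) (nhdsWithin (0:ℝ) (Set.Ioi 0)) (nhds κ)) →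
    ∃ (μT : MeasureTheory.Measure Literature.MathematicalPhysics.KineticTheory.HeatConduction.ChainConfig) (D : Literature.MathematicalPhysics.KineticTheory.HeatConduction.InfiniteChainDynamics (Literature.MathematicalPhysics.KineticTheory.HeatConduction.pinnedChain ω₂ lam β γ)) (κ : ℝ),
    ((Literature.MathematicalPhysics.KineticTheory.HeatConduction.pinnedChain ω₂ lam β γ).IsChainGibbsMeasure T μT ∧ D.PreservesMeasure μT ∧
    (∀ t : ℝ, D.HasAbsConvergentCorrelation μT t) ∧ 0 < κ ∧
    Filter.Tendsto (fun ν : ℝ => (T ^ 2)⁻¹ * MeasureTheory.integral (MeasureTheory.volume.restrict (Set.Ioi (0:ℝ)))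
    (fun t : ℝ => Real.exp (-(ν * t)) * (D.currentCorrelation μT) t)) (nhdsWithin (0:ℝ) (Set.Ioi 0)) (nhds κ)) ∧
    ∀ μ : (N : ℕ) → ℝ → ℝ → MeasureTheory.Measure (Literature.MathematicalPhysics.KineticTheory.HeatConduction.PhaseSpace N),
    (∀ (N : ℕ) (T_L T_R : ℝ), 0 < T_L → 0 < T_R → (Literature.MathematicalPhysics.KineticTheory.HeatConduction.pinnedChain ω₂ lam β γ).IsSteadyState N T_L T_R (μ N T_L T_R)) →
    ∀ Dn : ℕ → ℝ,
    (∀ N : ℕ, Filter.Tendsto (fun δ : ℝ => (Literature.MathematicalPhysics.KineticTheory.HeatConduction.pinnedChain ω₂ lam β γ).totalCurrent (μ N (T + δ / 2) (T - δ / 2)) / δ)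
    (nhdsWithin 0 {(0 : ℝ)}ᶜ) (nhds (Dn N))) →
    Filter.Tendsto Dn Filter.atTop (nhds κ) := by
  intro hR ω₂ lam β γ hω hl hβ hγ hU T hT hex
  obtain ⟨μ₁, D₁, κ, hG₁, hS₁, hP₁, hAC₁, hκ, hlim₁⟩ := hex
  refine ⟨μ₁, D₁, κ, ⟨hG₁, hP₁, hAC₁, hκ, hlim₁⟩, ?_⟩
  intro μ hμ Dn hD
  haveI : IsProbabilityMeasure μ₁ := hG₁.1
  have htight := Literature.MathematicalPhysics.KineticTheory.HeatConduction.oneSiteTight_of_isShiftInvariant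
    (μ := μ₁) hS₁
  obtain ⟨hS, hss⟩ :=
    OscillatorChain.isShiftInvariant_and_hasSuperstabilityEstimate_of_tight_pinnedChain γ hω hl.le hβ.le hT hG₁ htight
  obtain ⟨D, hcar, hP, hAC, hAbel⟩ := exists_regularDynamics_sameKappa hω hl hβ D₁ hss hP₁ hAC₁ hlim₁
  -- the finite-chain objects
  obtain ⟨c, hc⟩ : ∃ c : ℕ → ℝ → ℝ, c = fun (N : ℕ) (t : ℝ) =>
      ∫ z, (∑ i : Fin N, (pinnedChain ω₂ lam β γ).bondCurrent N i z) *
        (∫ y, (∑ i : Fin N, (pinnedChain ω₂ lam β γ).bondCurrent N i y)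
          ∂((pinnedChain ω₂ lam β γ).transitionKernel N T T t.toNNReal z))
        ∂((pinnedChain ω₂ lam β γ).gibbsMeasure N T) := ⟨_, rfl⟩
  set Ahat : ℝ → ℝ := fun ν => ∫ t in Ioi (0 : ℝ), Real.exp (-(ν * t)) * D.currentCorrelation μ₁ t with hAhat
  have hmatch0 := fixedFrequencyMatching_of_registeredLeaves stub_uniformAnchoredCorrelationTails
    stub_uniformFixedTimeOffsetMatching ω₂ lam β γ hω hl hβ hγ T hT
    (stub_regularDLRUnique ω₂ lam β γ hω hl hβ hγ T hT) μ₁ D hG₁ hS hss hcar hP hAC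
  have hM : ∀ ν : ℝ, 0 < ν → Tendsto (fun N : ℕ => (∫ t in Ioi (0:ℝ), Real.exp (-(ν * t)) * c N t) / (N : ℝ))
      atTop (𝓝 (Ahat ν)) := fun ν hν => by
    simpa only [hc, hAhat] using hmatch0 ν hν
  have hK' : ∀ N : ℕ, IntegrableOn (c N) (Ioi 0) ∧ ((N : ℝ) - 1) * T ^ 2 * Dn N = ∫ t in Ioi (0 : ℝ), c N t :=
    fun N => by
      simpa only [hc] using
        StaticAbelianSqueeze.kuboAbelIdentity_holds ω₂ lam β γ hω hl hβ hγ hU μ hμ T hT N (Dn N) (hD N)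
  have hT2 : (T ^ 2) ≠ 0 := by positivity
  have hT2pos : (0 : ℝ) < T ^ 2 := by positivity
  have hA : Tendsto Ahat (𝓝[>] 0) (𝓝 (T ^ 2 * κ)) := by
    have h := hAbel.const_mul (T ^ 2)
    refine h.congr' (Eventually.of_forall fun ν => ?_)
    simp only [hAhat]
    rw [← mul_assoc, mul_inv_cancel₀ hT2, one_mul]
  have hRI : ∀ ε : ℝ, 0 < ε → ∃ ν₀ : ℝ, 0 < ν₀ ∧ ∀ ν : ℝ, 0 < ν → ν < ν₀ → ∃ N₀ : ℕ, ∀ N : ℕ, N₀ ≤ N →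
      |∫ t in Ioi (0:ℝ), (1 - Real.exp (-(ν * t))) * c N t| ≤ ε * N := by
    intro ε hε
    obtain ⟨ν₀, hν₀, hRν⟩ := hR ω₂ lam β γ hω hl hβ hγ T hT ε hε
    refine ⟨ν₀, hν₀, fun ν hν hlt => ?_⟩
    obtain ⟨N₀, hN₀⟩ := hRν ν hν hlt
    refine ⟨N₀, fun N hN => ?_⟩
    simpa only [hc] using hN₀ N hN
  exact tendsto_of_regularity_matching_abel
    (fun N ν => ∫ t in Ioi (0:ℝ), Real.exp (-(ν * t)) * c N t)
    (fun N ν => ∫ t in Ioi (0:ℝ), (1 - Real.exp (-(ν * t))) * c N t)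
    (fun N => ∫ t in Ioi (0:ℝ), c N t) Ahat Dn (T ^ 2) κ hT2pos
    (fun ν hν N => integral_abelSplit (c N) ν hν (hK' N).1)
    (fun N => (hK' N).2) hRI hM hA

/-- **(R) and the seam SI prove the crux BY NAME**: the crux as filed is open exactly at {(R) = stmt-13416, SI = the planner
repair}. [folklore] -/
theorem abelThermodynamicLimit_of_uniformAbelianRegularity
    (hR : Summit.AtomisticToContinuum.FouriersLaw.Theses.StaticAbelianSqueeze.UniformAbelianRegularity)
    (hSI :
      ∀ ω₂ lam β γ : ℝ, 0 < ω₂ → 0 < lam → 0 < β → 0 < γ → ∀ T : ℝ, 0 < T →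
      (∃ (μT : MeasureTheory.Measure Literature.MathematicalPhysics.KineticTheory.HeatConduction.ChainConfig)
      (D' : Literature.MathematicalPhysics.KineticTheory.HeatConduction.InfiniteChainDynamics (Literature.MathematicalPhysics.KineticTheory.HeatConduction.pinnedChain ω₂ lam β γ)) (κ : ℝ),
      (Literature.MathematicalPhysics.KineticTheory.HeatConduction.pinnedChain ω₂ lam β γ).IsChainGibbsMeasure T μT ∧ D'.PreservesMeasure μT ∧
      (∀ t : ℝ, D'.HasAbsConvergentCorrelation μT t) ∧ 0 < κ ∧
      Filter.Tendsto (fun ν : ℝ => (T ^ 2)⁻¹ * MeasureTheory.integral (MeasureTheory.volume.restrict (Set.Ioi (0:ℝ)))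
      (fun t : ℝ => Real.exp (-(ν * t)) * D'.currentCorrelation μT t)) (nhdsWithin (0:ℝ) (Set.Ioi 0)) (nhds κ)) →
      ∃ (μT : MeasureTheory.Measure Literature.MathematicalPhysics.KineticTheory.HeatConduction.ChainConfig)
      (D' : Literature.MathematicalPhysics.KineticTheory.HeatConduction.InfiniteChainDynamics (Literature.MathematicalPhysics.KineticTheory.HeatConduction.pinnedChain ω₂ lam β γ)) (κ : ℝ),
      (Literature.MathematicalPhysics.KineticTheory.HeatConduction.pinnedChain ω₂ lam β γ).IsChainGibbsMeasure T μT ∧ Literature.MathematicalPhysics.KineticTheory.HeatConduction.IsShiftInvariant μT ∧ D'.PreservesMeasure μT ∧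
      (∀ t : ℝ, D'.HasAbsConvergentCorrelation μT t) ∧ 0 < κ ∧
      Filter.Tendsto (fun ν : ℝ => (T ^ 2)⁻¹ * MeasureTheory.integral (MeasureTheory.volume.restrict (Set.Ioi (0:ℝ)))
      (fun t : ℝ => Real.exp (-(ν * t)) * D'.currentCorrelation μT t)) (nhdsWithin (0:ℝ) (Set.Ioi 0)) (nhds κ)) :
    Summit.AtomisticToContinuum.FouriersLaw.Theses.LatticeLandauDamping.AbelThermodynamicLimit := by
  intro ω₂ lam β γ hω hl hβ hγ hU T hT hex
  exact stub_repairedCruxOfUniformAbelianRegularity hR ω₂ lam β γ hω hl hβ hγ hU T hT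
    (hSI ω₂ lam β γ hω hl hβ hγ T hT hex)

/-- **Converse: the (R)-estimate at a point carrying a shift-invariant witness follows from `Dn → κ`.** For `P` (all `> 0`),
`Uniq`, `T > 0`, a witness `(μT, D, κ)` with shift-invariant DLR state, a steady family and a response sequence `Dn` with
`Dn → κ`: `∀ ε > 0 ∃ ν₀ > 0 ∀ ν ∈ (0, ν₀)`, eventually in `N`, `|∫₀^∞ (1 − e^{-νt}) c_N| ≤ εN` — (R) at `(ω₂, lam, β, γ, T)`.
So given Abelian witnesses, the repaired crux and (R) are equivalent, and QS ∧ QSR imply (R). [folklore] -/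
theorem regularityEstimate_of_tendsto {ω₂ lam β γ : ℝ} (hω : 0 < ω₂) (hl : 0 < lam) (hβ : 0 < β) (hγ : 0 < γ)
    (hU : ∀ (N : ℕ) (T_L T_R : ℝ), 0 < T_L → 0 < T_R → ∀ μ ν : Measure (PhaseSpace N),
      (pinnedChain ω₂ lam β γ).IsSteadyState N T_L T_R μ → (pinnedChain ω₂ lam β γ).IsSteadyState N T_L T_R ν → μ = ν)
    {T : ℝ} (hT : 0 < T) {μT : Measure ChainConfig} {D₁ : InfiniteChainDynamics (pinnedChain ω₂ lam β γ)} {κ : ℝ}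
    (hG₁ : (pinnedChain ω₂ lam β γ).IsChainGibbsMeasure T μT) (hS₁ : IsShiftInvariant μT)
    (hP₁ : D₁.PreservesMeasure μT) (hAC₁ : ∀ t : ℝ, D₁.HasAbsConvergentCorrelation μT t)
    (hlim₁ : Tendsto (fun ν : ℝ => (T ^ 2)⁻¹ *
      ∫ t in Ioi (0 : ℝ), Real.exp (-(ν * t)) * D₁.currentCorrelation μT t) (𝓝[>] 0) (𝓝 κ))
    (μ : (N : ℕ) → ℝ → ℝ → Measure (PhaseSpace N))
    (hμ : ∀ (N : ℕ) (T_L T_R : ℝ), 0 < T_L → 0 < T_R → (pinnedChain ω₂ lam β γ).IsSteadyState N T_L T_R (μ N T_L T_R))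
    (Dn : ℕ → ℝ)
    (hD : ∀ N : ℕ, Tendsto (fun δ : ℝ => (pinnedChain ω₂ lam β γ).totalCurrent (μ N (T + δ / 2) (T - δ / 2)) / δ)
      (𝓝[≠] 0) (𝓝 (Dn N)))
    (hconv : Tendsto Dn atTop (𝓝 κ)) :
    ∀ ε : ℝ, 0 < ε → ∃ ν₀ : ℝ, 0 < ν₀ ∧ ∀ ν : ℝ, 0 < ν → ν < ν₀ → ∃ N₀ : ℕ, ∀ N : ℕ, N₀ ≤ N →
      |∫ t in Ioi (0:ℝ), (1 - Real.exp (-(ν * t))) *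
        ∫ z, (∑ i : Fin N, (pinnedChain ω₂ lam β γ).bondCurrent N i z) *
          (∫ y, (∑ i : Fin N, (pinnedChain ω₂ lam β γ).bondCurrent N i y)
            ∂((pinnedChain ω₂ lam β γ).transitionKernel N T T t.toNNReal z))
          ∂((pinnedChain ω₂ lam β γ).gibbsMeasure N T)| ≤ ε * N := by
  haveI : IsProbabilityMeasure μT := hG₁.1
  have htight := Literature.MathematicalPhysics.KineticTheory.HeatConduction.oneSiteTight_of_isShiftInvariant
    (μ := μT) hS₁
  obtain ⟨hS, hss⟩ :=
    OscillatorChain.isShiftInvariant_and_hasSuperstabilityEstimate_of_tight_pinnedChain γ hω hl.le hβ.le hT hG₁ htight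
  obtain ⟨D, hcar, hP, hAC, hAbel⟩ := exists_regularDynamics_sameKappa hω hl hβ D₁ hss hP₁ hAC₁ hlim₁
  obtain ⟨c, hc⟩ : ∃ c : ℕ → ℝ → ℝ, c = fun (N : ℕ) (t : ℝ) =>
      ∫ z, (∑ i : Fin N, (pinnedChain ω₂ lam β γ).bondCurrent N i z) *
        (∫ y, (∑ i : Fin N, (pinnedChain ω₂ lam β γ).bondCurrent N i y)
          ∂((pinnedChain ω₂ lam β γ).transitionKernel N T T t.toNNReal z))
        ∂((pinnedChain ω₂ lam β γ).gibbsMeasure N T) := ⟨_, rfl⟩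
  set Ahat : ℝ → ℝ := fun ν => ∫ t in Ioi (0 : ℝ), Real.exp (-(ν * t)) * D.currentCorrelation μT t with hAhat
  have hmatch0 := fixedFrequencyMatching_of_registeredLeaves stub_uniformAnchoredCorrelationTails
    stub_uniformFixedTimeOffsetMatching ω₂ lam β γ hω hl hβ hγ T hT
    (stub_regularDLRUnique ω₂ lam β γ hω hl hβ hγ T hT) μT D hG₁ hS hss hcar hP hAC
  have hM : ∀ ν : ℝ, 0 < ν → Tendsto (fun N : ℕ => (∫ t in Ioi (0:ℝ), Real.exp (-(ν * t)) * c N t) / (N : ℝ))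
      atTop (𝓝 (Ahat ν)) := fun ν hν => by
    simpa only [hc, hAhat] using hmatch0 ν hν
  have hK' : ∀ N : ℕ, IntegrableOn (c N) (Ioi 0) ∧ ((N : ℝ) - 1) * T ^ 2 * Dn N = ∫ t in Ioi (0 : ℝ), c N t :=
    fun N => by
      simpa only [hc] using
        StaticAbelianSqueeze.kuboAbelIdentity_holds ω₂ lam β γ hω hl hβ hγ hU μ hμ T hT N (Dn N) (hD N)
  have hT2 : (T ^ 2) ≠ 0 := by positivity
  have hT2pos : (0 : ℝ) < T ^ 2 := by positivity
  have hA : Tendsto Ahat (𝓝[>] 0) (𝓝 (T ^ 2 * κ)) := by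
    have h := hAbel.const_mul (T ^ 2)
    refine h.congr' (Eventually.of_forall fun ν => ?_)
    simp only [hAhat]
    rw [← mul_assoc, mul_inv_cancel₀ hT2, one_mul]
  have key := regularity_of_tendsto_matching_abel
    (fun N ν => ∫ t in Ioi (0:ℝ), Real.exp (-(ν * t)) * c N t)
    (fun N ν => ∫ t in Ioi (0:ℝ), (1 - Real.exp (-(ν * t))) * c N t)
    (fun N => ∫ t in Ioi (0:ℝ), c N t) Ahat Dn (T ^ 2) κ hT2pos
    (fun ν hν N => integral_abelSplit (c N) ν hν (hK' N).1)
    (fun N => (hK' N).2) hM hA hconv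
  intro ε hε
  obtain ⟨ν₀, hν₀, h⟩ := key ε hε
  refine ⟨ν₀, hν₀, fun ν hν hlt => ?_⟩
  obtain ⟨N₀, hN₀⟩ := h ν hν hlt
  refine ⟨N₀, fun N hN => ?_⟩
  simpa only [hc] using hN₀ N hN

end Summit.AtomisticToContinuum.FouriersLaw.Theorems.AbelThermodynamicLimit.SeriesLawAtEveryLaplaceFrequency

end
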